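import Summits.BirchSwinnertonDyer.BirchSwinnertonDyer.Theses.KolyvaginRoadThree
import Summits.BirchSwinnertonDyer.BirchSwinnertonDyer.Theorems.KolyvaginRoadThreeHalvesTamAtThreeValueContinuityB
import Mathlib
import HarnessLib

/-!
# BC3 birth skeleton — crux `HalvesTamAtThreeR` (route `KolyvaginRoadThree`, @3 ORIENT edit, planner g30)

The re-typed (RE-ORIENTED) halves parent at 3 decomposes EXACTLY as its misoriented predecessor did:
(VC₃) value continuity at the trivial character (the route's shared open child 19493 `ValueContinuityAtThree`,
stub 1 — same statement) and the re-oriented two-loci H3 child `IMCDivTwoLociTamAtThreeR` (stub 2 — same statement as the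
route item of that name, which replaces 19506). The composition `HalvesTamAtThreeR_of` is bsd-stepL-bdp g16's twin
`Theorems.kolyvaginRoadThree_halvesTamAtThree_of_valueContinuity_of_imcDivTamStubB` (tree, accepted 2026-08-27), kernel-checked here.
A `--split` of `HalvesTamAtThreeR` onto the existing decl `ValueContinuityAtThree` is refused by the gate (name reuse ∕
same-statement alias), so this registered skeleton IS the parent's decomposition of record (BC6 skeleton-aware cone).
-/

open scoped BigOperators Topology Manifold Classical MeasureTheory ProbabilityTheory Matrix InnerProductSpace ComplexConjugate ContinuousMap
open Filter Set Function TopologicalSpace MeasureTheory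
open Literature

set_option linter.dupNamespace false
set_option autoImplicit false

namespace Summit.BirchSwinnertonDyer.BirchSwinnertonDyer.Cruxes.HalvesTamAtThreeR.Birth

/-- stub 1 (= item stmt-BirchSwinnertonDyer-19493 `ValueContinuityAtThree`, shared K2@3 ∕ KOLY; thmc lineage). -/
theorem stub_valueContinuityAtThree :
    ∀ (W : WeierstrassCurve ℚ) [W.IsElliptic] [W.IsGloballyMinimal], ∀ (N : ℕ) [NeZero N] (K : Type) [Field K] [NumberField K] (Dt : Literature.NumberTheory.EllipticCurves.ModularForms.ModularParametrizationData W N) (H : Literature.NumberTheory.EllipticCurves.HeegnerDatum N (NumberField.discr K)) (ι : K →+* ℂ) (P : (W.baseChange K).toAffine.Point), Summit.BirchSwinnertonDyer.Rank1Residual.ClassX11b W 3 → Literature.NumberTheory.EllipticCurves.Rank1Residual.Surj W 3 → W.conductorNorm ℤ = N → Literature.NumberTheory.EllipticCurves.IsImaginaryQuadratic K → Odd (NumberField.discr K) → Literature.NumberTheory.EllipticCurves.SatisfiesHeegnerHypothesis N K → (W.quadraticTwist (NumberField.discr K : ℚ)).entireLFunction 1 ≠ 0 → WeierstrassCurve.Affine.Point.map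 ι.toRatAlgHom P = Literature.NumberTheory.EllipticCurves.ModularForms.heegnerPointComplex Dt H → ¬ (3 : ℤ) ∣ Dt.c → ¬ IsOfFinAddOrder P → ∀ (κ : Literature.NumberTheory.EllipticCurves.ZpExtension K 3), κ.IsAnticyclotomic → ∀ (γ : Field.absoluteGaloisGroup K) [Fact (κ.IsTopGenerator γ)] (𝔭 : IsDedekindDomain.HeightOneSpectrum (NumberField.RingOfIntegers K)) (h𝔭 : ((3 : ℕ) : NumberField.RingOfIntegers K) ∈ 𝔭.asIdeal) (he : 𝔭.asIdeal.ramificationIdx (NumberField.RingOfIntegers ℚ) = 1) (hf : 𝔭.asIdeal.inertiaDeg (NumberField.RingOfIntegers ℚ) = 1), ∀ (f : CuspForm (CongruenceSubgroup.Gamma0 N) 2), Literature.NumberTheory.EllipticCurves.ModularForms.IsNewformOf W f → ∀ (ι' : PadicAlgCl 3 ≃+* ℂ), Summit.BirchSwinnertonDyer.Rank1Residual.X11b.Three.InducesPrime ι' 𝔭 → ∃ (ΩK : ℂ) (Ωp : ℂ_[3]) (u : (Literature.NumberTheory.EllipticCurves.unrIntegers 3)ˣ), ΩK ≠ 0 ∧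 Ωp ≠ 0 ∧ ∀ (φ : ℕ → Literature.NumberTheory.GaloisRepresentations.HeckeCharacter K) (n : ℕ → ℕ) (r : ℕ → Literature.NumberTheory.GaloisRepresentations.FramedGaloisRep K (PadicAlgCl 3) 1), (∀ k, 0 < n k) → (∀ k (v : IsDedekindDomain.HeightOneSpectrum (NumberField.RingOfIntegers K)), (φ k).IsUnramifiedAt v) → (∀ k, (φ k).HasInfinityType (fun _ ↦ (n k : ℤ)) (fun _ ↦ -(n k : ℤ))) → (∀ k, Literature.NumberTheory.EllipticCurves.IsPAdicAvatarOf ι' (φ k) (r k)) → (∀ k, Literature.NumberTheory.EllipticCurves.FactorsThroughZp κ (r k)) → Filter.Tendsto (fun k ↦ Literature.NumberTheory.EllipticCurves.avatarValueAt (r k) γ) Filter.atTop (nhds 1) → Filter.Tendsto (fun k ↦ ((ι'.symm (Literature.NumberTheory.EllipticCurves.bdpInterpolationValue 3 f 𝔭 (φ k) (n k) ΩK) : PadicAlgCl 3) : ℂ_[3]) * Ωp ^ (4 * n k)) Filter.atTop (nhds (((u : Literature.NumberTheory.EllipticCurves.unrIntegers 3) : ℂ_[3]) * (algebraMap ℚ_[3]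 ℂ_[3] (((1 : ℚ_[3]) - ((W.LFunction 3 : ℤ) : ℚ_[3]) * (3 : ℚ_[3])⁻¹) * Summit.BirchSwinnertonDyer.Rank1Residual.X11b.Halves.logOmega W 3 (Summit.BirchSwinnertonDyer.Rank1Residual.X11b.embAt K 3 𝔭 h𝔭 he hf) P)) ^ 2)) := by
  sorry

/-- stub 2 (= the route item `IMCDivTwoLociTamAtThreeR`: H3ᴮ on the two loci of class X11b@3; imc ∕ bdp lineage). -/
theorem stub_imcDivTwoLociTamAtThreeR :
    ∀ (W : WeierstrassCurve ℚ) [W.IsElliptic] [W.IsGloballyMinimal], Summit.BirchSwinnertonDyer.Rank1Residual.ClassX11b W 3 → (Literature.NumberTheory.EllipticCurves.Rank1Residual.Ram W 3 → W.HasSplitMultiplicativeReductionAtPrime 3 → 3 ∣ W.tamagawaProduct → Summit.BirchSwinnertonDyer.Rank1Residual.X11b.Three.IMCDivAt₃B W) ∧ (¬ Literature.NumberTheory.EllipticCurves.Rank1Residual.Ram W 3 → Literature.NumberTheory.EllipticCurves.Rank1Residual.Surj W 3 → Summit.BirchSwinnertonDyer.Rank1Residual.X11b.Three.IMCDivAt₃B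 W) := by
  sorry

/-! ## Stub statements by name -/

namespace Statement

/-- Statement of `stub_valueContinuityAtThree`. -/
abbrev stub_valueContinuityAtThree : Prop := type_of% @Birth.stub_valueContinuityAtThree
/-- Statement of `stub_imcDivTwoLociTamAtThreeR`. -/
abbrev stub_imcDivTwoLociTamAtThreeR : Prop := type_of% @Birth.stub_imcDivTwoLociTamAtThreeR

end Statement

/-- Composition (sorry-free): the two stub STATEMENTS give the crux BY NAME (bdp g16 twin `kolyvaginRoadThree_halvesTamAtThree_of_valueContinuity_of_imcDivTamStubB`). -/
theorem HalvesTamAtThreeR_of (hVC : Statement.stub_valueContinuityAtThree) (h3 : Statement.stub_imcDivTwoLociTamAtThreeR) :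
    Summit.BirchSwinnertonDyer.BirchSwinnertonDyer.Theses.KolyvaginRoadThree.HalvesTamAtThreeR :=
  fun W _ _ hX ↦ Summit.BirchSwinnertonDyer.BirchSwinnertonDyer.Theorems.kolyvaginRoadThree_halvesTamAtThree_of_valueContinuity_of_imcDivTamStubB hVC h3 W hX

/-- The crux along this line, MODULO exactly the registered stubs (sorries only in open `stub_*`). -/
theorem HalvesTamAtThreeR_proof :
    Summit.BirchSwinnertonDyer.BirchSwinnertonDyer.Theses.KolyvaginRoadThree.HalvesTamAtThreeR :=
  HalvesTamAtThreeR_of stub_valueContinuityAtThree stub_imcDivTwoLociTamAtThreeR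

end Summit.BirchSwinnertonDyer.BirchSwinnertonDyer.Cruxes.HalvesTamAtThreeR.Birth
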